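import Literature.MathematicalPhysics.QuantumFieldTheory.Balaban1983to89.B16NodeKnitRecordPinned
import Literature.MathematicalPhysics.QuantumFieldTheory.Balaban1983to89.Node00.Record8

/-!
# `Balaban1983to89.B16NodeKnitRecordPinned8C` — YM-DAG node N13 · [Balaban1989LargeFieldII] CMP **122** (1989) 355–392, Theorem 1 p. 355 + (0.1), Cor. 3
# pp. 387 ∕ 391: the F-n24T-1 census and the pinned one-record knit CARRIED UP TO NODE 00's Stages ₇C ∕ ₈C (`IsRecordOfRecord₇C ∕ ₈C`): the residual
# 𝐑-carrier `θ.res.V` is STILL residual there (`residualOfStage7 ∕ 8` overwrite `βfun, χ, dom, E, R`, the actions and formats — not `V`), so «the 𝐑-leaf at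
# every ₇C ∕ ₈C record world» is again UNSATISFIABLE, and the satisfiable one-record form is the world's leaf, through the refinements to ₅C

statement-level bookkeeping over published theorems with citation tags; kernel-checked compositions of tree theorems;
nothing here is a claim about the Yang–Mills mass gap.

CITATION HEADER (lean-in-tree rule).  Source: T. Bałaban, *Large field renormalization. II. Localization, exponentiation, and bounds for the
𝐑 operation*, Commun. Math. Phys. **122**, 355–392 (1989), doi:10.1007/bf01238433 [Balaban1989LargeFieldII] (cell paper B16 = «[V]»), with
[Balaban1988Convergent] («[III]»: the ASSUMED 𝐑 of p. 244 = the leaf `DagBinding.ROpLeaf`; Cor. 3 (2.50) p. 264).  Seat `pub-ymgap-dag-n13-a` (YM-PLAN Track A, HUMAN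
RULING D-0062: the KNIT-BY-NAME seat of node N13), module 11 of the seat.  BY NAME and UNCHANGED: `…B16NodeKnitRecordPinned` (module 9: `datumOfRecord₅_updV`,
`not_rOpLeaf_emptyTarget`, `not_forall_atDatum_rOpLeaf₅C`, `forall_pinned_rOpLeaf_iff_rOperation₅C`, `b16_main_reExp_of_isRecordOfRecord₅C_pinned`,
`b16_main_of_isRecordOfRecord₅C_of_leaf`), `…Node00.Record7 ∕ Record8` (seat node00-def: `Stage7Params`, `Stage8Params`, `residualOfStage7 ∕ 8`, `Stage7Params.toStage5`,
`Stage8Params.toStage5`, `IsRecordOfRecord₇C ∕ ₈C`, `isRecordOfRecord₅C_of_isRecordOfRecord₇C ∕ ₈C`), `…B16NodeKnitRecord5C` (module 6: `rOperation_iff_rOpLeaf_res₅C`),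
`…DagBinding` (`PrintedCarriers14R`, `ROpLeaf`, `WorldP`).

WHY THIS FILE (referee dag-ref-D g7 [REFD-G7-… F-n24T-1-INHERITED], 2026-08-26: the unpinned 𝐑-slot propagates into the Stage-₈ glue).  Module 9 certified, at
Stage 5, that no UNIVERSAL form of N13's 𝐑-slot is satisfiable and re-issued the one-record knits on the world's leaf.  NODE 00's Stages ₇C (def-R's χ, dom, E, R of
record) and ₈C (def-B's β, actions, formats of record) refine ₅C but leave the 𝐑-carrier `V` in the residual: swapping it in a Stage-7 ∕ Stage-8 parameter changes
neither admissibility, nor `residualOfStage7 ∕ 8` except in its `V` field, nor therefore the datum — so a ₇C ∕ ₈C record world re-bound to the swapped parameters is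
again a ₇C ∕ ₈C record over the same datum, with a failing leaf.  Hence the Stage-₈ glue's N13 input must be the pinned one-record form too; §2 states it at ₇C ∕ ₈C
(by refinement to ₅C — the knit itself is module 9's).

WHAT THIS FILE PROVES (0 `sorry`, 0 `def`, standard axioms).
§1 `toStage5_updV₇ ∕ ₈` (the Stage-5 view of the carrier-swapped parameters IS the carrier-swapped Stage-5 view, `rfl`); `isRecordOfRecord₇C_updV ∕ ₈C_updV` (re-binding
   a record world to the swapped parameters is again a record over the SAME datum); **`not_forall_record_rOperation₇C ∕ ₈C`** (form (c) at ₇C ∕ ₈C is false given one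
   record); `not_forall_atDatum_rOpLeaf₈C` (form (b) at a ₈C record, by refinement); `forall_pinned_rOpLeaf_iff_rOperation₈C` (pinned Stage-8 form ↔ the world's leaf).
§2 `b16_main_reExp_of_isRecordOfRecord₈C_pinned` ∕ `…₇C_pinned` (module 9's pinned re-lettered knit at a ₈C ∕ ₇C record, by refinement), `b16_main_of_isRecordOfRecord₈C_of_leaf`.

HONEST FRAMING.  Count-neutral bookkeeping (census + the pinned socket one and two stages up); N13 NOT discharged; at Stages ₇C ∕ ₈C its 𝐑-product is the
world's leaf as a HYPOTHESIS (dischargeable once `V` is pinned, Stage ₉C); nothing of Bałaban's asserted; one finite four-torus programme at fixed `ε`; nothing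
continuum ∕ ℝ⁴ ∕ OS ∕ mass gap ∕ Clay.
-/

noncomputable section

namespace Literature.MathematicalPhysics.QuantumFieldTheory.Balaban1983to89.B16NodeKnitRecordPinned8C

open DagBinding T4DatumAssembly T4Continuum Node00 FlowStepRuns
open B16NodeKnitRecordPinned (datumOfRecord₅_updV not_rOpLeaf_emptyTarget not_forall_atDatum_rOpLeaf₅C forall_pinned_rOpLeaf_iff_rOperation₅C
  b16_main_reExp_of_isRecordOfRecord₅C_pinned b16_main_of_isRecordOfRecord₅C_of_leaf)
open B16NodeKnitRecord5C (rOperation_iff_rOpLeaf_res₅C)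

variable {F : T4Family} {N : ℕ} [NeZero N]

/-! ## §1. The census one and two stages up: `V` is still residual at ₇C ∕ ₈C -/

section Census

/-- The Stage-5 view of carrier-swapped Stage-7 parameters is the carrier-swapped Stage-5 view (`residualOfStage7` does not overwrite `V`; `rfl`).
[cite: Balaban1988Convergent, (2.16)–(2.17) p.257 (bookkeeping: the Stage-7 substitutions)] -/
theorem toStage5_updV₇ (θ : Stage7Params F N) (V' : B12.RunParams → PrintedCarriers14R) :
    Stage7Params.toStage5 F N { θ with res := { θ.res with V := V' } } =
      { Stage7Params.toStage5 F N θ with res := { (Stage7Params.toStage5 F N θ).res with V := V' } } := rfl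

/-- The Stage-5 view of carrier-swapped Stage-8 parameters is the carrier-swapped Stage-5 view (`residualOfStage8` does not overwrite `V`; `rfl`).
[cite: Balaban1987RG1, (0.22) p.256 (bookkeeping: the Stage-8 substitutions)] -/
theorem toStage5_updV₈ (θ : Stage8Params F N) (V' : B12.RunParams → PrintedCarriers14R) :
    Stage8Params.toStage5 F N { θ with res := { θ.res with V := V' } } =
      { Stage8Params.toStage5 F N θ with res := { (Stage8Params.toStage5 F N θ).res with V := V' } } := rfl

variable {D : FiniteEpsData F (SU N)} {w : WorldP}

/-- Re-binding a `₇C` record's world to the carrier-swapped parameters is again a `₇C` record over the SAME datum. [cite: Balaban1989LargeFieldII, Thm 1 p.355 (bookkeeping: the record predicate)] -/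
theorem isRecordOfRecord₇C_updV (h : IsRecordOfRecord₇C F N D w) :
    ∃ θ : Stage7Params F N, θ.Admissible ∧ (∀ P, w.up P = upOfRecord₅C F N (θ.toStage5 F N) P) ∧
      ∀ V' : B12.RunParams → PrintedCarriers14R,
        IsRecordOfRecord₇C F N D
          { w with up := fun P => upOfRecord₅C F N (Stage7Params.toStage5 F N { θ with res := { θ.res with V := V' } }) P } := by
  obtain ⟨θ, hθ, hD, hC, hγ, hL, hup⟩ := h
  refine ⟨θ, hθ, hup, fun V' => ⟨{ θ with res := { θ.res with V := V' } }, hθ, ?_, hC, hγ, hL, fun _ => rfl⟩⟩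
  rw [toStage5_updV₇, datumOfRecord₅_updV]
  exact hD

/-- Re-binding an `₈C` record's world to the carrier-swapped parameters is again an `₈C` record over the SAME datum. [cite: Balaban1989LargeFieldII, Thm 1 p.355 (bookkeeping: the record predicate)] -/
theorem isRecordOfRecord₈C_updV (h : IsRecordOfRecord₈C F N D w) :
    ∃ θ : Stage8Params F N, θ.Admissible ∧ (∀ P, w.up P = upOfRecord₅C F N (θ.toStage5 F N) P) ∧
      ∀ V' : B12.RunParams → PrintedCarriers14R,
        IsRecordOfRecord₈C F N D
          { w with up := fun P => upOfRecord₅C F N (Stage8Params.toStage5 F N { θ with res := { θ.res with V := V' } }) P } := by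
  obtain ⟨θ, hθ, hD, hC, hγ, hL, hup⟩ := h
  refine ⟨θ, hθ, hup, fun V' => ⟨{ θ with res := { θ.res with V := V' } }, hθ, ?_, hC, hγ, hL, fun _ => rfl⟩⟩
  rw [toStage5_updV₈, datumOfRecord₅_updV]
  exact hD

/-- **Form (c) is unsatisfiable at Stage ₇C**: given ONE `₇C` record, «the 𝐑-leaf holds at every run of every `₇C` record world» is FALSE.
[cite: Balaban1988Convergent, p.244 (bookkeeping: Stage-7 scoping of the 𝐑-slot)] -/
theorem not_forall_record_rOperation₇C (h : IsRecordOfRecord₇C F N D w) :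
    ¬ ∀ (D' : FiniteEpsData F (SU N)) (w' : WorldP), IsRecordOfRecord₇C F N D' w' → ∀ P : B12.RunParams, (w'.up P).rOperation := by
  intro hR
  obtain ⟨θ, -, -, hrec⟩ := isRecordOfRecord₇C_updV h
  exact not_rOpLeaf_emptyTarget (θ.res.V ⟨0, F.m, 1⟩)
    (hR D _ (hrec fun P => { θ.res.V P with K := 1, Scorr := fun _ _ => True, S := fun _ _ => False }) ⟨0, F.m, 1⟩)

/-- **Form (c) is unsatisfiable at Stage ₈C**: given ONE `₈C` record, «the 𝐑-leaf holds at every run of every `₈C` record world» is FALSE — the Stage-₈ glue's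
N13 input cannot be a universal 𝐑-slot either. [cite: Balaban1988Convergent, p.244 (bookkeeping: Stage-8 scoping of the 𝐑-slot)] -/
theorem not_forall_record_rOperation₈C (h : IsRecordOfRecord₈C F N D w) :
    ¬ ∀ (D' : FiniteEpsData F (SU N)) (w' : WorldP), IsRecordOfRecord₈C F N D' w' → ∀ P : B12.RunParams, (w'.up P).rOperation := by
  intro hR
  obtain ⟨θ, -, -, hrec⟩ := isRecordOfRecord₈C_updV h
  exact not_rOpLeaf_emptyTarget (θ.res.V ⟨0, F.m, 1⟩)
    (hR D _ (hrec fun P => { θ.res.V P with K := 1, Scorr := fun _ _ => True, S := fun _ _ => False }) ⟨0, F.m, 1⟩)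

/-- Form (b) (Stage-5 parameters of the datum) is unsatisfiable at every `₈C` record — by refinement to ₅C (module 9). [cite: Balaban1988Convergent, p.244 (bookkeeping)] -/
theorem not_forall_atDatum_rOpLeaf₈C (h : IsRecordOfRecord₈C F N D w) :
    ¬ ∀ θ : Stage5Params F N, θ.Admissible → D = datumOfRecord₅ F N θ → ∀ P : B12.RunParams, ROpLeaf (θ.res.V P) :=
  not_forall_atDatum_rOpLeaf₅C (isRecordOfRecord₅C_of_isRecordOfRecord₈C h)

/-- **The satisfiable Stage-8 form**: at an `₈C` record, the 𝐑-slot «for the Stage-8 parameters of the datum that bind the world» is PRECISELY the world's leaf.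
[cite: Balaban1988Convergent, p.244 (bookkeeping)] -/
theorem forall_pinned_rOpLeaf_iff_rOperation₈C (h : IsRecordOfRecord₈C F N D w) :
    (∀ θ : Stage8Params F N, θ.Admissible → D = datumOfRecord₅ F N (θ.toStage5 F N) →
        (∀ P, w.up P = upOfRecord₅C F N (θ.toStage5 F N) P) → ∀ P : B12.RunParams, ROpLeaf ((θ.toStage5 F N).res.V P)) ↔
      ∀ P : B12.RunParams, (w.up P).rOperation := by
  refine ⟨fun hR P => ?_, fun hw θ' _ _ hup' P => (rOperation_iff_rOpLeaf_res₅C F N _ w P (hup' P)).1 (hw P)⟩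
  obtain ⟨θ, hθ, hD, -, -, -, hup⟩ := h
  exact (rOperation_iff_rOpLeaf_res₅C F N _ w P (hup P)).2 (hR θ hθ hD hup P)

end Census

/-! ## §2. The pinned one-record knit at ₇C ∕ ₈C (module 9 through the refinements) -/

section Repair

variable {D : FiniteEpsData F (SU N)} {w : WorldP}

/-- **N13 at the re-lettered `₈C` record world, (R) := the world's leaf** — module 9's `b16_main_reExp_of_isRecordOfRecord₅C_pinned` through
`isRecordOfRecord₅C_of_isRecordOfRecord₈C`; the shape the Stage-₈ glue (seat dag-n24-a) consumes. [cite: Balaban1989LargeFieldII, Thm 1 p.355, p.387, p.391; Balaban1988Convergent, p.244, Cor. 3 (2.50) p.264] -/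
theorem b16_main_reExp_of_isRecordOfRecord₈C_pinned (eM eP : FiniteEpsData F (SU N) → ℝ → ℝ) (h : IsRecordOfRecord₈C F N D w)
    (hR : ∀ P : B12.RunParams, (w.up P).rOperation)
    (hcor : ∀ θ : Stage5Params F N, θ.Admissible → D = datumOfRecord₅ F N θ →
      ∃ R : B14Cor3.ReprFamily (datumOfRecord₅ F N θ).C,
        B14Cor3.LeafH (datumOfRecord₅ F N θ).C R w.γ ∧ B14Cor3.LeafU1 (datumOfRecord₅ F N θ).C R w.γ ∧
        B14Cor3.LeafU2 (datumOfRecord₅ F N θ).C R w.γ (eP D) ∧ B14Cor3.LeafL1 (datumOfRecord₅ F N θ).C R w.γ ∧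
        B14Cor3.LeafL2 (datumOfRecord₅ F N θ).C R w.γ (eM D)) :
    ∀ P : B12.RunParams, Dag.B16_main (leavesP { w with em := eM D, ep := eP D } P) :=
  b16_main_reExp_of_isRecordOfRecord₅C_pinned eM eP (isRecordOfRecord₅C_of_isRecordOfRecord₈C h) hR hcor

/-- The `₇C` twin of `b16_main_reExp_of_isRecordOfRecord₈C_pinned`. [cite: Balaban1989LargeFieldII, Thm 1 p.355, p.387, p.391; Balaban1988Convergent, p.244, Cor. 3 (2.50) p.264] -/
theorem b16_main_reExp_of_isRecordOfRecord₇C_pinned (eM eP : FiniteEpsData F (SU N) → ℝ → ℝ) (h : IsRecordOfRecord₇C F N D w)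
    (hR : ∀ P : B12.RunParams, (w.up P).rOperation)
    (hcor : ∀ θ : Stage5Params F N, θ.Admissible → D = datumOfRecord₅ F N θ →
      ∃ R : B14Cor3.ReprFamily (datumOfRecord₅ F N θ).C,
        B14Cor3.LeafH (datumOfRecord₅ F N θ).C R w.γ ∧ B14Cor3.LeafU1 (datumOfRecord₅ F N θ).C R w.γ ∧
        B14Cor3.LeafU2 (datumOfRecord₅ F N θ).C R w.γ (eP D) ∧ B14Cor3.LeafL1 (datumOfRecord₅ F N θ).C R w.γ ∧
        B14Cor3.LeafL2 (datumOfRecord₅ F N θ).C R w.γ (eM D)) :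
    ∀ P : B12.RunParams, Dag.B16_main (leavesP { w with em := eM D, ep := eP D } P) :=
  b16_main_reExp_of_isRecordOfRecord₅C_pinned eM eP (isRecordOfRecord₅C_of_isRecordOfRecord₇C h) hR hcor

/-- **N13 at one `₈C` record world, (R) := the leaf, (UV₅) := [III] p. 264's five leaves at `D.C` with the world's own letters.**
[cite: Balaban1989LargeFieldII, Thm 1 p.355, p.387; Balaban1988Convergent, p.244, Cor. 3 (2.50) p.264] -/
theorem b16_main_of_isRecordOfRecord₈C_of_leaf (h : IsRecordOfRecord₈C F N D w) (hR : ∀ P : B12.RunParams, (w.up P).rOperation)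
    (R : B14Cor3.ReprFamily D.C) (hH : B14Cor3.LeafH D.C R w.γ) (hU1 : B14Cor3.LeafU1 D.C R w.γ) (hU2 : B14Cor3.LeafU2 D.C R w.γ w.ep)
    (hL1 : B14Cor3.LeafL1 D.C R w.γ) (hL2 : B14Cor3.LeafL2 D.C R w.γ w.em) :
    ∀ P : B12.RunParams, Dag.B16_main (leavesP w P) :=
  b16_main_of_isRecordOfRecord₅C_of_leaf (isRecordOfRecord₅C_of_isRecordOfRecord₈C h) hR R hH hU1 hU2 hL1 hL2

end Repair

end Literature.MathematicalPhysics.QuantumFieldTheory.Balaban1983to89.B16NodeKnitRecordPinned8C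

end
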